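import Summits.MatrixMultiplication.OmegaCensus.STPPZoo313Checker
import Summits.MatrixMultiplication.OmegaCensus.STPPVosperSlackTwoCheckersSound

/-!
# ω-census (abelian STPP census): soundness pieces for the zoo checker — SEMANTICS of the bit-parallel failure counters (kernel tool)

HONEST FRAMING (pub-omega census; verbatim): lottery ticket; floor = certified bounds/negative ranges.
Census STRUCTURE (seat pub-omega-stpp-1 gen 33, 2026-08-29), family (b2).  Second soundness piece for `zooLeaf` (`STPPZoo313Checker.lean`): the fold of
`stepCnt p S` over a list of SUCCESS masks `Ss` (all `< 2^p`), started from `[fullMask p, 0, …, 0]` (`K + 1` counters), ends with counters `cs` such that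
bit `y` of `cs[j]` is set iff `y < p` and exactly `j` of the masks in `Ss` do NOT contain `y` (`tb_foldl_stepCnt`).  In particular the last counter collects
the `y < p` with exactly `K` failures (`tb_getLastD_foldl_stepCnt`).  Pieces remaining for the zoo theorem: the identity `|{0,1,y} + Y| = 13 + r + #failures`
and the passage from a 13-subset of `ℤ/61` to its difference sequence (successor; HOME `pub-omega-stpp-1-g33/FIFTH-LEAF.md`).  No `decide`.
Nothing here is progress on `ω`.

References: H. Cohn, R. Kleinberg, B. Szegedy, C. Umans, FOCS 2005 (arXiv:math/0511460), Def. 5.1.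
-/

namespace Summit.MatrixMultiplication.OmegaCensus.CubeNB.S2

open Summit.MatrixMultiplication.OmegaCensus.CubeNB.Bits

/-! ## §1 Shape of `stepCnt` -/

/-- `stepCnt.rest` preserves length. [folklore] -/
theorem length_stepCnt_rest (p S : ℕ) : ∀ (prev : ℕ) (cs : List ℕ), (stepCnt.rest p S prev cs).length = cs.length
  | _, [] => rfl
  | prev, c :: cs => by rw [stepCnt.rest, List.length_cons, List.length_cons, length_stepCnt_rest p S c cs]

/-- `stepCnt` preserves length. [folklore] -/
theorem length_stepCnt (p S : ℕ) : ∀ (cs : List ℕ), (stepCnt p S cs).length = cs.length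
  | [] => rfl
  | c0 :: cs => by rw [stepCnt, List.length_cons, List.length_cons, length_stepCnt_rest]

/-- Entries of `stepCnt.rest`: entry `j` is `(cs[j] ∧ S) ∨ ((prev :: cs)[j] ∧ ¬S)`. [folklore] -/
theorem getD_stepCnt_rest (p S : ℕ) : ∀ (prev : ℕ) (cs : List ℕ) (j : ℕ), j < cs.length →
    (stepCnt.rest p S prev cs).getD j 0 = ((cs.getD j 0 &&& S) ||| ((prev :: cs).getD j 0 &&& (fullMask p ^^^ S)))
  | _, [], j, hj => absurd hj (Nat.not_lt_zero _)
  | prev, c :: cs, 0, _ => by simp [stepCnt.rest]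
  | prev, c :: cs, j + 1, hj => by
    rw [stepCnt.rest, List.getD_cons_succ, List.getD_cons_succ, List.getD_cons_succ]
    exact getD_stepCnt_rest p S c cs j (by simpa using hj)

/-- Entry `0` of `stepCnt`. [folklore] -/
theorem getD_stepCnt_zero (p S c0 : ℕ) (cs : List ℕ) : (stepCnt p S (c0 :: cs)).getD 0 0 = (c0 &&& S) := by
  simp [stepCnt]

/-- Entry `j + 1` of `stepCnt`: `(cs[j+1] ∧ S) ∨ (cs[j] ∧ ¬S)`. [folklore] -/
theorem getD_stepCnt_succ (p S : ℕ) (cs : List ℕ) (j : ℕ) (hj : j + 1 < cs.length) :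
    (stepCnt p S cs).getD (j + 1) 0 = ((cs.getD (j + 1) 0 &&& S) ||| (cs.getD j 0 &&& (fullMask p ^^^ S))) := by
  rcases cs with _ | ⟨c0, cs⟩
  · simp at hj
  · rw [stepCnt, List.getD_cons_succ, List.getD_cons_succ]
    exact getD_stepCnt_rest p S c0 cs j (by simpa using hj)

/-! ## §2 Semantics of the fold -/

/-- The number of masks in `Ss` NOT containing bit `y`. [folklore] -/
def failCount (Ss : List ℕ) (y : ℕ) : ℕ := (Ss.filter fun S => !(tb S y)).length

/-- **Invariant of the counter fold.**  If every counter `cs[j]` has bit `y` set iff `y < p ∧ c = j`, then after folding `stepCnt p S` over masks `Ss`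
(all `< 2^p`) the counter `j` has bit `y` set iff `y < p ∧ c + failCount Ss y = j`. [folklore] -/
theorem tb_foldl_stepCnt (p y : ℕ) : ∀ (Ss : List ℕ) (cs : List ℕ) (c : ℕ), (∀ S ∈ Ss, S < 2 ^ p) →
    (∀ j, j < cs.length → (tb (cs.getD j 0) y = true ↔ (y < p ∧ c = j))) →
    ∀ j, j < cs.length → (tb ((Ss.foldl (fun cs S => stepCnt p S cs) cs).getD j 0) y = true ↔ (y < p ∧ c + failCount Ss y = j))
  | [], cs, c, _, hinv, j, hj => by simpa [failCount] using hinv j hj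
  | S :: Ss, cs, c, hSs, hinv, j, hj => by
    rw [List.foldl_cons]
    have hS : S < 2 ^ p := hSs S (by simp)
    have hlen : (stepCnt p S cs).length = cs.length := length_stepCnt p S cs
    -- the invariant after one step, with the count advanced by this mask's failure bit
    have hstep : ∀ j, j < (stepCnt p S cs).length →
        (tb ((stepCnt p S cs).getD j 0) y = true ↔ (y < p ∧ (c + cond (tb S y) 0 1) = j)) := by
      intro j' hj'
      rw [hlen] at hj'
      rcases cs with _ | ⟨c0, cs⟩
      · simp at hj'
      rcases j' with _ | j'
      · have h0 := hinv 0 hj'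
        rw [List.getD_cons_zero] at h0
        rw [getD_stepCnt_zero, tb_land, Bool.and_eq_true, h0]
        constructor
        · rintro ⟨⟨hyp, hc⟩, hs⟩
          exact ⟨hyp, by rw [hs]; simpa using hc⟩
        · rintro ⟨hyp, hc⟩
          cases hs : tb S y
          · rw [hs] at hc; simp at hc
          · rw [hs] at hc; exact ⟨⟨hyp, by simpa using hc⟩, rfl⟩
      · rw [getD_stepCnt_succ p S (c0 :: cs) j' hj', tb_lor, Bool.or_eq_true, tb_land, tb_land, Bool.and_eq_true, Bool.and_eq_true,
          hinv (j' + 1) hj', hinv j' (by omega)]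
        constructor
        · rintro (⟨⟨hyp, hc⟩, hs⟩ | ⟨⟨hyp, hc⟩, hns⟩)
          · exact ⟨hyp, by rw [hs]; simpa using hc⟩
          · rw [tb_compl hyp] at hns
            have hs : tb S y = false := by simpa using hns
            exact ⟨hyp, by rw [hs]; simp; omega⟩
        · rintro ⟨hyp, hc⟩
          cases hs : tb S y
          · right
            rw [hs] at hc
            refine ⟨⟨hyp, by simpa using hc⟩, ?_⟩
            rw [tb_compl hyp, hs]; rfl
          · left
            rw [hs] at hc
            exact ⟨⟨hyp, by simpa using hc⟩, rfl⟩
    have key := tb_foldl_stepCnt p y Ss (stepCnt p S cs) (c + cond (tb S y) 0 1) (fun S' hS' => hSs S' (by simp [hS'])) hstep j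
      (by rw [hlen]; exact hj)
    rw [key]
    have hfc : failCount (S :: Ss) y = cond (tb S y) 0 1 + failCount Ss y := by
      unfold failCount
      rw [List.filter_cons]
      cases tb S y <;> simp [Nat.add_comm]
    rw [hfc]
    constructor
    · rintro ⟨hyp, h⟩; exact ⟨hyp, by omega⟩
    · rintro ⟨hyp, h⟩; exact ⟨hyp, by omega⟩

/-- The initial counters `[fullMask p, 0, …, 0]` satisfy the invariant with count `0`. [folklore] -/
theorem tb_initCnt (p y K : ℕ) : ∀ j, j < (fullMask p :: List.replicate K 0).length →
    (tb ((fullMask p :: List.replicate K 0).getD j 0) y = true ↔ (y < p ∧ 0 = j)) := by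
  intro j hj
  rcases j with _ | j
  · rw [List.getD_cons_zero, tb_fullMask, decide_eq_true_eq]; simp
  · rw [List.getD_cons_succ, List.getD_eq_getElem?_getD, List.getElem?_replicate]
    rw [List.length_cons, List.length_replicate] at hj
    rw [if_pos (by omega)]
    simp [tb_zero]

/-- **The last counter collects the `y < p` with exactly `K` failures.** [folklore] -/
theorem tb_getLastD_foldl_stepCnt (p y K : ℕ) (Ss : List ℕ) (hSs : ∀ S ∈ Ss, S < 2 ^ p) :
    tb ((Ss.foldl (fun cs S => stepCnt p S cs) (fullMask p :: List.replicate K 0)).getLastD 0) y = true ↔ (y < p ∧ failCount Ss y = K) := by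
  have hlenfold : ∀ (Ts : List ℕ) (cs : List ℕ), (Ts.foldl (fun cs S => stepCnt p S cs) cs).length = cs.length := by
    intro Ts; induction Ts with
    | nil => intro cs; rfl
    | cons T Ts ih => intro cs; rw [List.foldl_cons, ih, length_stepCnt]
  set res := Ss.foldl (fun cs S => stepCnt p S cs) (fullMask p :: List.replicate K 0) with hres
  have hlen : res.length = K + 1 := by rw [hres, hlenfold]; simp
  have hlast : res.getLastD 0 = res.getD K 0 := by
    rw [List.getLastD_eq_getLast?, List.getLast?_eq_getElem?, List.getD_eq_getElem?_getD, hlen, Nat.add_sub_cancel]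
  rw [hlast, hres]
  have := tb_foldl_stepCnt p y Ss (fullMask p :: List.replicate K 0) 0 hSs (tb_initCnt p y K) K (by simp)
  rw [this]
  simp

end Summit.MatrixMultiplication.OmegaCensus.CubeNB.S2
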